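import Mathlib.FieldTheory.IsAlgClosed.Basic
import Mathlib.LinearAlgebra.Dimension.Finrank
import Mathlib.LinearAlgebra.Dimension.Constructions
import Mathlib.AlgebraicGeometry.Morphisms.Smooth
import Literature.AlgebraicGeometry.Motives.PeriodComparison
import Literature.AlgebraicGeometry.Motives.FamiliesVHS
import Literature.AlgebraicGeometry.Motives.AbelianVariety
import HarnessLib

-- D-0014 sorry-sweep (operator, 2026-08-13): sorried theorems -> named facts `def X : Prop`; partial proofs preserved in comments
-- provenance: harness21/H21/H21/Statements/Hodge/ComparisonAbsolute.lean @ 2642559 (interim HEAD d8f2665); M5 mechanical rewrite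
/-!
# The Betti–de Rham comparison and absolute Hodge classes: target statements
(family Hodge, trunk MotiveL)

This file states the targets **hodge.S18** (Grothendieck's comparison theorem
`Hⁱ_dR(X/k) ⊗_{k,σ} ℂ ≅ Hⁱ((σX)(ℂ), ℚ) ⊗ ℂ` and Hodge-to-de Rham degeneration at `E₁`;
Grothendieck, *On the de Rham cohomology of algebraic varieties*, Publ. IHÉS 29 (1966), Thm. 1';
Deligne–Illusie, Invent. Math. 89 (1987)) and **hodge.S19** (absolute Hodge classes; Deligne,
*Hodge cycles on abelian varieties*, LNM 900 (1982), §2, Main Thm. 2.11 and Thm. 2.12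
"Principle B") against a period realization `P : Literature.PeriodRealization k` (prelude C9 of the
trunk, a hypothesis structure recording the comparison data).

* **hodge.S18.** The consequences that are *formal* in the fields of `P` are honest theorems:
  `bijective_iso'` (the comparison map is bijective), `finrank_dR_eq_finrank_betti`
  (`dim_k Hⁱ_dR(X) = dim_ℚ Hⁱ((σX)(ℂ), ℚ)`, proved), `hodgeNumber_dR_eq_hodgeNumber_betti`
  (`h^{p,q}` computed from the algebraic Hodge filtration equals `h^{p,q}` of the Hodge structure
  on Betti cohomology; depends only on `iso_fil`, `isoEquiv` and the Hodge decomposition, proof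
  `sorry`), and the `E₁`-degeneration clause `sum_hodgeNumber_eq_finrank`
  (`∑ₚ h^{p,i-p}(X) = dim_ℚ Hⁱ((σX)(ℂ), ℚ)`, from `DeRhamRealization.sum_hodgeNumber`).
* **hodge.S19.** The definition of absolute Hodge classes is `P.IsAbsoluteHodge` (prelude C9);
  `cycleClass_isAbsoluteHodge'` restates that cycle classes are absolute Hodge (Deligne 1982,
  Ex. 2.1(a); honest). Deligne's Main Theorem 2.11 (on an abelian variety over an algebraically
  closed field of characteristic zero every Hodge class is absolute Hodge) and Principle B
  (Thm. 2.12) are deep theorems about the *classical* realization; following the trunk policy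
  (outline §1, TRUNKS design 1) they are recorded as `Prop`-valued definitions
  `DeligneAbsoluteHodgeStatement P`, `PrincipleBStatement P` — theorems for the classical
  period realization, not provable for an arbitrary `P`.

## Design notes

* Mathlib has no de Rham/Betti comparison, Hodge numbers or absolute Hodge classes (searched
  `absoluteHodge`, `hodgeNumber`, `deRham`, `periodIso`: nothing relevant). We use Mathlib's
  `Module.finrank`, `Module.finrank_baseChange`, `LinearEquiv.finrank_eq`, `IsAlgClosed`,
  `AlgebraicGeometry.Smooth`, `ConnectedSpace`.
* `(P.B.comap σ).obj X i` is by definition `P.B.W.obj ((baseChangeHom σ).obj X) i`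
  (`PreWeilCohomology.comap_obj`, `rfl`); statements are written with the latter, as in the
  outline.
* In `DeligneAbsoluteHodgeStatement` the smoothness witness `hAσ` of the base change is a bound
  variable (as in `P.IsHodgeRelativeTo`); `IsSmoothProjective` is a `Prop`, so this is the same as
  using `A.isSmoothProjective.baseChangeHom σ`.
* `PrincipleBStatement` is phrased for a global de Rham class `α ∈ H²ᵖ_dR(𝒳/k)` on the total
  space of a smooth projective family `f : 𝒳 ⟶ S` (its restrictions to the fibres
  `fiberOver f s` form a horizontal family, which is how Deligne's horizontal global section of
  `R²ᵖ f_* Ω•` is realised without a Gauss–Manin connection), over `k` algebraically closed and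
  `S` smooth and connected, with Deligne's hypotheses: Hodge relative to a fixed `σ₀` at every
  rational point, absolute Hodge at one point.
* Universe `0` throughout (forced by `PeriodRealization`).

## References

* A. Grothendieck, *On the de Rham cohomology of algebraic varieties*, Publ. IHÉS 29 (1966).
* P. Deligne, L. Illusie, *Relèvements modulo p² et décomposition du complexe de de Rham*,
  Invent. Math. 89 (1987).
* P. Deligne, *Hodge cycles on abelian varieties*, in LNM 900 (1982), §2, Thm. 2.11, Thm. 2.12.
* F. Charles, C. Schnell, *Notes on absolute Hodge classes* (2011), §2–§3.
-/

open CategoryTheory AlgebraicGeometry Opposite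
open scoped TensorProduct

noncomputable section

namespace Literature.AlgebraicGeometry.Motives

section Hodge

variable {k : Type} [Field k] [CharZero k] (P : PeriodRealization k)

/-! ### hodge.S18: the comparison isomorphism and `E₁`-degeneration -/

section Comparison

variable {n : ℕ} {X : SchemeOver k}

/-- **hodge.S18** (Grothendieck's comparison theorem; Grothendieck 1966, Thm. 1'). For `X`
smooth projective over `k` and `σ : k →+* ℂ`, the comparison map
`Hⁱ_dR(X/k) ⊗_{k,σ} ℂ → Hⁱ((σX)(ℂ), ℚ) ⊗_ℚ ℂ` is bijective. Depends only on: `isoInv_iso`,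
`iso_isoInv` (this is `P.bijective_iso`, restated with its inventory id). [cite: Grothendieck1966, Thm. 1'] -/
theorem bijective_iso' (σ : k →+* ℂ) (hX : IsSmoothProjective n X) (i : ℕ) :
    Function.Bijective (P.iso σ X i) :=
  P.bijective_iso σ hX i

/-- **hodge.S18** (Grothendieck 1966, Thm. 1', numerical form). For `X` smooth projective over
`k` and `σ : k →+* ℂ`, `dim_k Hⁱ_dR(X/k) = dim_ℚ Hⁱ((σX)(ℂ), ℚ)`: both sides equal the
`ℂ`-dimension of the two ends of the comparison isomorphism (`Module.finrank_baseChange`).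
Depends only on: `isoInv_iso`, `iso_isoInv`. [cite: Grothendieck1966, Thm. 1'  numerical form] -/
theorem finrank_dR_eq_finrank_betti (σ : k →+* ℂ) (hX : IsSmoothProjective n X) (i : ℕ) :
    Module.finrank k (P.dR.obj X i) =
      Module.finrank ℚ (P.B.W.obj ((baseChangeHom σ).obj X) i) := by
  rw [← Module.finrank_baseChange (R := AlongHom ℂ σ) (M' := P.dR.obj X i),
    (P.isoEquiv σ hX i).finrank_eq]
  exact Module.finrank_baseChange

/-- **hodge.S18** (compatibility of the comparison with the Hodge filtrations; Grothendieck 1966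
with GAGA, Deligne, *Théorie de Hodge II*, 2.2 and 3.2). For `X` smooth projective and
`σ : k →+* ℂ`, the Hodge numbers `h^{p,q}(X) = dim_k gr_F^p H^{p+q}_dR(X/k)` of the algebraic
Hodge filtration agree with the Hodge numbers `dim_ℂ H^{p,q}` of the pure Hodge structure on
`Hⁱ((σX)(ℂ), ℚ)`. Depends only on: `iso_fil`, `isoEquiv`, and the Hodge decomposition of
`P.B.hodge` (`HodgeStructure.F_eq_iSup_piece`, `piece_eq_bot_of_add_ne`). [cite: Grothendieck1966, with GAGA  Deligne   Théorie de Hodge II] -/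
def hodgeNumber_dR_eq_hodgeNumber_betti : Prop :=
  ∀ (σ : k →+* ℂ) (hX : IsSmoothProjective n X) (hXσ : IsSmoothProjective n ((baseChangeHom σ).obj X)) (i : ℕ) (p q : ℤ),
    P.dR.hodgeNumber X i p q = (P.B.hodge hXσ i).hodgeNumber p q

/-- **hodge.S18** (Hodge-to-de Rham degeneration at `E₁`, numerical form; Deligne–Illusie 1987;
Deligne, *Théorie de Hodge II*, 2.3.7). For `X` smooth projective and `σ : k →+* ℂ`,
`∑_{p=0}^{i} h^{p,i-p}(X) = dim_ℚ Hⁱ((σX)(ℂ), ℚ)`. Depends only on: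
`DeRhamRealization.sum_hodgeNumber` and `finrank_dR_eq_finrank_betti`. [cite: DeligneIllusie1987] -/
def sum_hodgeNumber_eq_finrank : Prop :=
  ∀ (σ : k →+* ℂ) (hX : IsSmoothProjective n X) (i : ℕ),
    ∑ p ∈ Finset.Icc (0 : ℤ) i, P.dR.hodgeNumber X i p (i - p) =
      Module.finrank ℚ (P.B.W.obj ((baseChangeHom σ).obj X) i)

/- interim proof relied on results that are now named facts (D-0014); demoted to a fact by the D-0014 sorry-sweep, proof preserved:
:= by
  rw [P.dR.sum_hodgeNumber hX i, DeRhamRealization.bettiNumber,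
    finrank_dR_eq_finrank_betti P σ hX i]
-/

end Comparison

/-! ### hodge.S19: absolute Hodge classes -/

section AbsoluteHodge

variable {n : ℕ} {X : SchemeOver k}

/-- **hodge.S19** (cycle classes are absolute Hodge; Deligne 1982, §2, Ex. 2.1(a);
Charles–Schnell 2011, Ex. 12). For a prime cycle of codimension `p` (the closure of a point `z`
of codimension `p`) on a smooth projective `X` of dimension `n`, its de Rham class is an
absolute Hodge class (`P.IsAbsoluteHodge`, Deligne 1982, Def. 2.10). Depends only on:
`iso_cycleClass`, `B.cycleClass_mem_hodgeClasses` (this is `P.cycleClass_isAbsoluteHodge`). [cite: Deligne1982, Def. 2.10] -/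
theorem cycleClass_isAbsoluteHodge' (hX : IsSmoothProjective n X) (p : ℕ) (z : X.left)
    (hz : Order.coheight z = p) : P.IsAbsoluteHodge n X p (P.dR.cycleClass X p z) :=
  P.cycleClass_isAbsoluteHodge hX p z hz

/-- **hodge.S19** (Deligne's theorem on absolute Hodge classes on abelian varieties; Deligne,
*Hodge cycles on abelian varieties*, LNM 900 (1982), Main Theorem 2.11). The statement: if `k`
is algebraically closed (of characteristic zero), then for every abelian variety `A` over `k`,
every `p` and every de Rham class `α ∈ H²ᵖ_dR(A/k)`, if `α` is a Hodge class relative to *one*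
embedding `σ : k →+* ℂ` then `α` is an absolute Hodge class. A `Prop`-valued definition: this
is a theorem for the classical period realization, not provable for an arbitrary `P`. [folklore] -/
def DeligneAbsoluteHodgeStatement (P : PeriodRealization k) : Prop :=
  IsAlgClosed k → ∀ (A : AbelianVariety k) (p : ℕ) (α : P.dR.obj A.X (2 * p)) (σ : k →+* ℂ)
    (hAσ : IsSmoothProjective A.dim ((baseChangeHom σ).obj A.X)),
    P.IsHodgeRelativeTo σ hAσ p α → P.IsAbsoluteHodge A.dim A.X p α

/-- **hodge.S19** (Deligne's **Principle B**; Deligne, *Hodge cycles on abelian varieties*,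
LNM 900 (1982), Thm. 2.12; Charles–Schnell 2011, §3.2). The statement: let `k` be algebraically
closed (of characteristic zero), `f : 𝒳 ⟶ S` a smooth projective family of relative dimension
`n` over a smooth connected `k`-scheme `S`, and `α ∈ H²ᵖ_dR(𝒳/k)` a global class whose
restriction `α|_{𝒳_s}` to every rational fibre `𝒳_s = fiberOver f s` is a Hodge class relative to
a fixed embedding `σ₀`. If `α|_{𝒳_{s₀}}` is absolute Hodge for one `s₀ ∈ S(k)`, then `α|_{𝒳_s}`
is absolute Hodge for every `s ∈ S(k)`. A `Prop`-valued definition: a theorem for the classical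
period realization, not provable for an arbitrary `P`. The smooth projectivity of the base-changed fibres is the named
fact `IsSmoothProjective.baseChangeHom` (D-0014), quantified as the hypothesis `hbc`. [cite: CharlesSchnell2011, §3.2] -/
def PrincipleBStatement (P : PeriodRealization k) : Prop :=
  IsAlgClosed k → ∀ ⦃𝒳 S : SchemeOver k⦄ (f : 𝒳 ⟶ S) (n : ℕ)
    (hf : IsSmoothProjectiveFamily f n), Smooth S.hom → ConnectedSpace S.left →
    ∀ (hbc : IsSmoothProjective.baseChangeHom (k := k) (L := ℂ)) (σ₀ : k →+* ℂ) (p : ℕ)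
      (α : P.dR.obj 𝒳 (2 * p)),
      (∀ s : AlgPoints S k, P.IsHodgeRelativeTo σ₀ (hbc σ₀ (hf.isSmoothProjective s))
        p (P.dR.pullback (fiberι f s) (2 * p) α)) →
      ∀ s₀ : AlgPoints S k,
        P.IsAbsoluteHodge n (fiberOver f s₀) p (P.dR.pullback (fiberι f s₀) (2 * p) α) →
        ∀ s : AlgPoints S k,
          P.IsAbsoluteHodge n (fiberOver f s) p (P.dR.pullback (fiberι f s) (2 * p) α)

end AbsoluteHodge

end Hodge

end Literature.AlgebraicGeometry.Motives

end
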